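import Literature.AlgebraicGeometry.HodgeTheory.ComplexOrientationFamily
import Literature.AlgebraicGeometry.HodgeTheory.SupportedClassesGysinSpan
import Literature.AlgebraicGeometry.HodgeTheory.ComplexGysinRational
import Literature.AlgebraicTopology.SingularHomology.PoincareDualityProofs
import Literature.AlgebraicTopology.SingularHomology.HomologyRingChange
import Literature.AlgebraicTopology.SingularHomology.IntersectionFormPositiveRealClass
import Literature.AlgebraicTopology.SingularHomology.IntegralClassRingChange
import Literature.AlgebraicTopology.SingularHomology.SteenrodSquares
import Literature.Geometry.Manifold.DeRhamFundamentalClassPairing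
import HarnessLib

/-!
# The Poincaré-dual class of a smooth fourfold in a smooth projective eightfold
(cell `hodge-kum4`, seat p2; the "`w`-bridge" of crux I)

HONEST FRAMING.  PROVED from the tree (no named-fact hypotheses beyond those already discharged in
the imported tree files): for `X` smooth projective of dimension `8`, `W` smooth projective of
dimension `4` and `i : W ⟶ X`, with the complex orientations `μ = complexOrientationInt hX`,
`ν = complexOrientationInt hW` of the tree:

* `exists_int_pdClass` — an INTEGRAL class `w ∈ H⁸(X(ℂ); ℤ)` with `w ⌢ [X(ℂ)] = i(ℂ)_*[W(ℂ)]`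
  (integral Poincaré duality, the tree's theorem `poincare_duality`);
* `real_pd_of_int_pd` — its real image satisfies `w_ℝ ⌢ [X]_ℝ = i(ℂ)_*[W]_ℝ`, the literal
  Poincaré-duality hypothesis of `Hirzebruch1969_gSignature_involution_halfDimFixedLocus.dim8`;
* `ringChange_int_pdClass_mem_algebraicClasses` — its complex image `w_ℂ` is ALGEBRAIC,
  `w_ℂ ∈ algebraicClasses X 4`: `w_ℂ` is a non-zero multiple of the Gysin class `i_* 1_W`
  (both cap to multiples of `i(ℂ)_*[W(ℂ)]`, fundamental classes of the closed connected `X(ℂ)`,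
  `W(ℂ)` with field coefficients being proportional, and `⌢ [X(ℂ)]` is injective), and Gysin images
  are supported in codimension `4` (`iSup_range_complexGysin_le_supportedClasses`);
* `kroneckerPairing_cup_ringChange_real/complex` — `⟨w_K ∪ w_K', [X]_K⟩ = ⟨w ∪ w', [X]⟩` for
  `K = ℝ, ℂ` (the tree's `kroneckerPairing_cupProduct_ringChange`), so the real self-intersection
  number of the `G`-signature theorem and the complex one of the crux clause are the same integer.
-/

noncomputable section

open CategoryTheory
open Literature.AlgebraicTopology.SingularHomology singularCochainComplex
open Literature.AlgebraicGeometry Literature.AlgebraicGeometry.HodgeTheory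
open Literature.Geometry.Manifold

namespace Summit.Ventures.HodgeKum4

variable {X W : Motives.SchemeOver ℂ}

/-! ### Change of rings `ℤ → ℝ → ℂ` on cohomology -/

/-- `(c ⊗_ℤ ℝ) ⊗_ℝ ℂ = c ⊗_ℤ ℂ` on singular cohomology classes. -/
theorem ringChange_real_ringChange_int {Y : Type} [TopologicalSpace Y] {k : ℕ}
    (c : singularCohomology ℤ ℤ Y k) :
    singularCohomology.ringChange (algebraMap ℝ ℂ) Y k
        (singularCohomology.ringChange (algebraMap ℤ ℝ) Y k c) =
      singularCohomology.ringChange (algebraMap ℤ ℂ) Y k c := by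
  induction c using singularCohomology_induction_on with
  | h ζ =>
    rw [singularCohomology.ringChange_π, singularCohomology.ringChange_π,
      singularCohomology.ringChange_π]
    congr 1
    refine coFn_injective ?_
    rw [coFn_cocyclesRingChange, coFn_cocyclesRingChange, coFn_cocyclesRingChange]
    funext σ
    simp only [Function.comp_apply, eq_intCast, Complex.ofReal_intCast, Complex.coe_algebraMap]

/-- `([z] ⊗_ℤ ℝ) ⊗_ℝ ℂ = [z] ⊗_ℤ ℂ` on singular homology classes. -/
theorem coeffChange_real_coeffChange_int {Y : Type} [TopologicalSpace Y] {k : ℕ}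
    (z : singularHomology ℤ ℤ Y k) :
    singularHomology.coeffChange Y (algebraMap ℝ ℂ : ℝ →+* ℂ).toAddMonoidHom k
        (singularHomology.coeffChange Y (algebraMap ℤ ℝ : ℤ →+* ℝ).toAddMonoidHom k z) =
      singularHomology.coeffChange Y (algebraMap ℤ ℂ : ℤ →+* ℂ).toAddMonoidHom k z := by
  rw [singularHomology.coeffChange_comp]
  congr 1

/-! ### The integral Poincaré-dual class -/

/-- **Integral Poincaré dual of a smooth fourfold in a smooth projective eightfold**: there is
`w ∈ H⁸(X(ℂ); ℤ)` with `w ⌢ [X(ℂ)] = i(ℂ)_*[W(ℂ)]` for the complex orientations of the tree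
(integral Poincaré duality `poincare_duality` on the closed `16`-manifold `X(ℂ)`). -/
theorem exists_int_pdClass (hX : Motives.IsSmoothProjective 8 X) (hW : Motives.IsSmoothProjective 4 W)
    (i : W ⟶ X) :
    ∃ w : singularCohomology ℤ ℤ (Motives.ComplexPoints X) 8,
      capProduct (M := ℤ) (rfl : 8 + 8 = 16) w (complexOrientationInt hX).fundamentalClass =
        singularHomology.map ℤ ℤ (Motives.AlgPoints.mapContinuous (L := ℂ) i) 8
          (complexOrientationInt hW).fundamentalClass := by
  letI := hX.chartedSpace
  haveI := Motives.ComplexPoints.compactSpace_of_isSmoothProjective hX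
  haveI := Motives.ComplexPoints.t2Space_of_isSmoothProjective hX
  have hPD := poincare_duality (complexOrientationInt hX) (p := 8) (q := 8) rfl
  obtain ⟨w, hw⟩ := hPD.2 (singularHomology.map ℤ ℤ (Motives.AlgPoints.mapContinuous (L := ℂ) i) 8
    (complexOrientationInt hW).fundamentalClass)
  exact ⟨w, hw⟩

/-- **Real Poincaré-duality equation** (the literal hypothesis shape of
`Hirzebruch1969_gSignature_involution_halfDimFixedLocus.dim8`): `w_ℝ ⌢ [X]_ℝ = i(ℂ)_*[W]_ℝ`. -/
theorem real_pd_of_int_pd (hX : Motives.IsSmoothProjective 8 X) (hW : Motives.IsSmoothProjective 4 W)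
    (i : W ⟶ X) {w : singularCohomology ℤ ℤ (Motives.ComplexPoints X) 8}
    (hw : capProduct (M := ℤ) (rfl : 8 + 8 = 16) w (complexOrientationInt hX).fundamentalClass =
      singularHomology.map ℤ ℤ (Motives.AlgPoints.mapContinuous (L := ℂ) i) 8
        (complexOrientationInt hW).fundamentalClass) :
    capProduct (M := ℝ) (rfl : 8 + 8 = 16)
        (singularCohomology.ringChange (algebraMap ℤ ℝ) (Motives.ComplexPoints X) 8 w)
        (singularHomology.coeffChange (Motives.ComplexPoints X)
          (algebraMap ℤ ℝ : ℤ →+* ℝ).toAddMonoidHom 16 (complexOrientationInt hX).fundamentalClass) =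
      singularHomology.map ℝ ℝ (Motives.AlgPoints.mapContinuous (L := ℂ) i) 8
        (singularHomology.coeffChange (Motives.ComplexPoints W)
          (algebraMap ℤ ℝ : ℤ →+* ℝ).toAddMonoidHom 8 (complexOrientationInt hW).fundamentalClass) := by
  rw [← singularHomology.coeffChange_capProduct, hw, singularHomology.coeffChange_map]

/-- **Complex Poincaré-duality equation**: `w_ℂ ⌢ [X]_ℂ = i(ℂ)_*[W]_ℂ`. -/
theorem complex_pd_of_int_pd (hX : Motives.IsSmoothProjective 8 X)
    (hW : Motives.IsSmoothProjective 4 W) (i : W ⟶ X)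
    {w : singularCohomology ℤ ℤ (Motives.ComplexPoints X) 8}
    (hw : capProduct (M := ℤ) (rfl : 8 + 8 = 16) w (complexOrientationInt hX).fundamentalClass =
      singularHomology.map ℤ ℤ (Motives.AlgPoints.mapContinuous (L := ℂ) i) 8
        (complexOrientationInt hW).fundamentalClass) :
    capProduct (M := ℂ) (rfl : 8 + 8 = 16)
        (singularCohomology.ringChange (algebraMap ℤ ℂ) (Motives.ComplexPoints X) 8 w)
        (singularHomology.coeffChange (Motives.ComplexPoints X)
          (algebraMap ℤ ℂ : ℤ →+* ℂ).toAddMonoidHom 16 (complexOrientationInt hX).fundamentalClass) =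
      singularHomology.map ℂ ℂ (Motives.AlgPoints.mapContinuous (L := ℂ) i) 8
        (singularHomology.coeffChange (Motives.ComplexPoints W)
          (algebraMap ℤ ℂ : ℤ →+* ℂ).toAddMonoidHom 8 (complexOrientationInt hW).fundamentalClass) := by
  rw [← singularHomology.coeffChange_capProduct, hw, singularHomology.coeffChange_map]

/-! ### Algebraicity of the complexified Poincaré-dual class -/

/-- **The complexified Poincaré dual of a smooth fourfold `W ⟶ X` is an algebraic class**,
`w_ℂ ∈ algebraicClasses X 4`: it is a multiple of the Gysin class `i_* 1_W`
(`complexGysin complexOrientationFamily`), which is supported in codimension `4`. -/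
theorem ringChange_int_pdClass_mem_algebraicClasses (hX : Motives.IsSmoothProjective 8 X)
    (hW : Motives.IsSmoothProjective 4 W) (i : W ⟶ X)
    {w : singularCohomology ℤ ℤ (Motives.ComplexPoints X) 8}
    (hw : capProduct (M := ℤ) (rfl : 8 + 8 = 16) w (complexOrientationInt hX).fundamentalClass =
      singularHomology.map ℤ ℤ (Motives.AlgPoints.mapContinuous (L := ℂ) i) 8
        (complexOrientationInt hW).fundamentalClass) :
    (singularCohomology.ringChange (algebraMap ℤ ℂ) (Motives.ComplexPoints X) 8 w :
      complexBetti X 8) ∈ algebraicClasses X 4 := by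
  set wC : complexBetti X 8 :=
    singularCohomology.ringChange (algebraMap ℤ ℂ) (Motives.ComplexPoints X) 8 w with hwC
  -- the Gysin class `G = i_* 1_W ∈ H⁸(X(ℂ); ℂ)`
  have hab : 0 + 2 * 8 = 8 + 2 * 4 := rfl
  set G : complexBetti X 8 := complexGysin complexOrientationFamily hW hX i hab
    (singularCohomology.one ℂ (Motives.ComplexPoints W)) with hGdef
  have hG : capProduct (M := ℂ) (rfl : 8 + 8 = 16) G (complexOrientationFamily hX).fundamentalClass =
      singularHomology.map ℂ ℂ (Motives.AlgPoints.mapContinuous (L := ℂ) i) 8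
        (complexOrientationFamily hW).fundamentalClass := by
    have h := capProduct_complexGysin (μ := complexOrientationFamily)
      hasPoincareDuality_complexOrientationFamily hW hX i hab (q := 8) (Nat.zero_add _) rfl
      (singularCohomology.one ℂ (Motives.ComplexPoints W))
    rw [one_capProduct] at h
    exact h
  -- proportionality of top classes on the closed connected manifolds `X(ℂ)`, `W(ℂ)`
  obtain ⟨r, hr⟩ : ∃ r : ℂ, singularHomology.coeffChange (Motives.ComplexPoints X)
      (algebraMap ℤ ℂ : ℤ →+* ℂ).toAddMonoidHom 16 (complexOrientationInt hX).fundamentalClass =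
        r • (complexOrientationFamily hX).fundamentalClass := by
    letI := hX.chartedSpace
    haveI := Motives.ComplexPoints.compactSpace_of_isSmoothProjective hX
    haveI := Motives.ComplexPoints.t2Space_of_isSmoothProjective hX
    haveI := connectedSpace_complexPoints hX
    exact exists_eq_smul_fundamentalClass_of_connectedSpace (complexOrientationFamily hX) _
  have hr0 : r ≠ 0 := by
    letI := hX.chartedSpace
    haveI := Motives.ComplexPoints.compactSpace_of_isSmoothProjective hX
    haveI := Motives.ComplexPoints.t2Space_of_isSmoothProjective hX
    haveI := connectedSpace_complexPoints hX
    rintro rfl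
    rw [zero_smul] at hr
    exact coeffChange_fundamentalClass_ne_zero ℂ (complexOrientationInt hX) hr
  obtain ⟨s, hs⟩ : ∃ s : ℂ, singularHomology.coeffChange (Motives.ComplexPoints W)
      (algebraMap ℤ ℂ : ℤ →+* ℂ).toAddMonoidHom 8 (complexOrientationInt hW).fundamentalClass =
        s • (complexOrientationFamily hW).fundamentalClass := by
    letI := hW.chartedSpace
    haveI := Motives.ComplexPoints.compactSpace_of_isSmoothProjective hW
    haveI := Motives.ComplexPoints.t2Space_of_isSmoothProjective hW
    haveI := connectedSpace_complexPoints hW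
    exact exists_eq_smul_fundamentalClass_of_connectedSpace (complexOrientationFamily hW) _
  -- the complex PD equation for `w_ℂ`, rewritten against `[X]_{cOF}`
  have hC := complex_pd_of_int_pd hX hW i hw
  rw [hr, hs, map_smul, map_smul] at hC
  -- `hC : r • (w_ℂ ⌢ [X]) = s • i_*[W]`, `hG : G ⌢ [X] = i_*[W]` ⇒ `(r • w_ℂ - s • G) ⌢ [X] = 0`
  have key : capProduct (M := ℂ) (rfl : 8 + 8 = 16) (r • wC - s • G)
      (complexOrientationFamily hX).fundamentalClass = 0 := by
    rw [map_sub, LinearMap.sub_apply, map_smul, map_smul, LinearMap.smul_apply,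
      LinearMap.smul_apply, hG, ← hC, hwC, sub_self]
  -- `⌢ [X(ℂ)]` is injective (Poincaré duality for the complex orientation family)
  have hinj := (hasPoincareDuality_complexOrientationFamily hX (p := 8) (q := 8) rfl).1
  have hzero : r • wC - s • G = 0 := by
    refine (injective_iff_map_eq_zero _).1 hinj _ ?_
    rw [poincareDualityMap_apply]
    exact key
  have hwG : wC = (r⁻¹ * s) • G := by
    have h1 : r • wC = s • G := sub_eq_zero.mp hzero
    calc wC = r⁻¹ • (r • wC) := by rw [smul_smul, inv_mul_cancel₀ hr0, one_smul]
      _ = (r⁻¹ * s) • G := by rw [h1, smul_smul]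
  rw [hwG]
  refine Submodule.smul_mem _ _ ?_
  -- `G ∈ G⁴ ≤ N⁴ H⁸ = algebraicClasses X 4`
  refine iSup_range_complexGysin_le_supportedClasses complexOrientationFamily hX 8 4 ?_
  refine Submodule.mem_iSup_of_mem 4 <| Submodule.mem_iSup_of_mem (by norm_num) <|
    Submodule.mem_iSup_of_mem W <| Submodule.mem_iSup_of_mem hW <| Submodule.mem_iSup_of_mem i <|
    Submodule.mem_iSup_of_mem 0 <| Submodule.mem_iSup_of_mem hab <| LinearMap.mem_range_self _ _

/-! ### Self-intersection numbers over `ℤ`, `ℝ`, `ℂ` agree -/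

/-- `⟨w_ℝ ∪ w'_ℝ, [X]_ℝ⟩ = ⟨w ∪ w', [X]⟩` for integral classes `w, w'` (any integral orientation). -/
theorem kroneckerPairing_cup_ringChange_real {Y : Type} [TopologicalSpace Y] {k n : ℕ} (h : k + k = n)
    (μ : HomologicalOrientation ℤ Y n)
    (c d : singularCohomology ℤ ℤ Y k) :
    kroneckerPairing ℝ ℝ Y n
        (cupProduct h (singularCohomology.ringChange (algebraMap ℤ ℝ) Y k c)
          (singularCohomology.ringChange (algebraMap ℤ ℝ) Y k d))
        (singularHomology.coeffChange Y (algebraMap ℤ ℝ : ℤ →+* ℝ).toAddMonoidHom n μ.fundamentalClass) =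
      (cupPairing μ h c d : ℝ) :=
  kroneckerPairing_cupProduct_ringChange ℝ h μ c d

/-- `⟨w_ℂ ∪ w'_ℂ, [X]_ℂ⟩ = ⟨w ∪ w', [X]⟩` for integral classes `w, w'` (any integral orientation). -/
theorem kroneckerPairing_cup_ringChange_complex {Y : Type} [TopologicalSpace Y] {k n : ℕ} (h : k + k = n)
    (μ : HomologicalOrientation ℤ Y n)
    (c d : singularCohomology ℤ ℤ Y k) :
    kroneckerPairing ℂ ℂ Y n
        (cupProduct h (singularCohomology.ringChange (algebraMap ℤ ℂ) Y k c)
          (singularCohomology.ringChange (algebraMap ℤ ℂ) Y k d))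
        (singularHomology.coeffChange Y (algebraMap ℤ ℂ : ℤ →+* ℂ).toAddMonoidHom n μ.fundamentalClass) =
      (cupPairing μ h c d : ℂ) :=
  kroneckerPairing_cupProduct_ringChange ℂ h μ c d

end Summit.Ventures.HodgeKum4

end
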